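import Summits.BirchSwinnertonDyer.BirchSwinnertonDyer.Theorems.AdditiveBranchIMCGordTwoRankZeroTransport
import HarnessLib

/-!
# Crux `GordTwoRankZeroOffCaseOne` (item 19357) and its parity halves (19244 / 19245) BY NAME from the
# route's OWN items: the Λ-adic branch children `GordTwoLambdaEven` (19497) / `GordTwoLambdaOdd` (19498)

Cell `bsd-addord`, seat `bsd-addord-k1-c2` (D-0074 row B1), gen 3. HONEST FRAMING: nothing here proves the
Birch–Swinnerton-Dyer conjecture, the crux, or either Λ-adic child; the two content children 19497 / 19498
(the Skinner–Urban `⊆ (𝓛)` direction on the ramified tame branch `ω^{(p−1)/2}` of the good ordinary twist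
model, off Case 1) are NOT in print (Skinner–Urban 2014 Thm. 3.6.4: trivial tame branch only; Wan 2015: `p`
unramified; Burungale–Skinner–Tian–Wan 2024 / Fouquet–Wan 2021 / Keller–Yin 2024: preprints, re-checked
2026-08-26) and stay OPEN. This file books nothing and closes nothing by itself.

WHAT IT RECORDS (route `AdditiveBranchIMC`, rev 11): the planner filed the rank-free Λ-adic lower
containments `GordTwoLambdaEven` / `GordTwoLambdaOdd` as children of crux 3 (`GordTwoRankOne`, 19358) and
declared them "the SAME statement [as] the layer-2 input of 19244 (rank 0, even)" resp. of 19245 — one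
conjecture item serving both cruxes (SPLIT-DRAFTS-g14 design (i)). The kernel form of that declaration is
below: the two Λ-adic children, together with the route's fact items `PrintedFacts` (19362: GZK, modularity,
a modular parametrisation), `ReadingFacts` (19361: Delbourgo 1998 Prop. 4 intrinsic) and — on the even branch
only — the period item `PalQuadraticTwistPeriod` (19587, Pal 2012 Thm. 3.2), imply the rank-0 halves
`GordTwoRankZeroOffCaseOneEven` / `GordTwoRankZeroOffCaseOneOdd` and the parent crux BY NAME. The
mathematics is gen 0's transport `missingLowerBoundAt_cellGordTwo_rankZero_of_chiBranchLowerDivisibility[Odd]`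
(p418190 §2: Λ-adic containment ⟹ `T = 0` leading-term divisibility since `ord_p j(E) ≥ 0` on the cell ⟹
`ord_p #Ш_an ≤ ord_p #Ш` by Delbourgo's exact constant term with the local tower kernel killed, GZK and
modularity; Pal's period relation moves `Ω_{E♭}` to `Ω_E` on the even branch, the odd branch carries its
own imaginary-period bookkeeping). So the day items 19497 and 19498 close, items 19244, 19245 and 19357
close by these class theorems (modulo the held fact items, exactly as the route's `closes`).

References: Delbourgo, Compositio Math. 113 (1998) Prop. 4 (p. 144), Main Conjecture (p. 151) [Delbourgo1998];
Pal, [Pal2012] Thm. 3.2; Mazur–Tate–Teitelbaum, Invent. Math. 84 (1986) §I.14 [MazurTateTeitelbaum1986Invent];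
Miller, LMS J. Comput. Math. 14 (2011) Def. 1.1 [Miller2011LMS]; Skinner–Urban, Invent. Math. 195 (2014)
Thm. 3.6.4 [SkinnerUrban2014].
-/

noncomputable section

open scoped Classical

open WeierstrassCurve Literature.NumberTheory.EllipticCurves
  Literature.NumberTheory.EllipticCurves.Rank1Residual
  Literature.NumberTheory.EllipticCurves.Rank1Residual.Typed

set_option autoImplicit false

namespace Summit.BirchSwinnertonDyer.BirchSwinnertonDyer.Theorems.AdditiveBranchIMCGordTwoRankZeroOfLambda

open Summit.BirchSwinnertonDyer.Rank1Residual
open Summit.BirchSwinnertonDyer.Rank1Residual.Additive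
open Summit.BirchSwinnertonDyer.BirchSwinnertonDyer.Theses.AdditiveBranchIMC
open Summit.BirchSwinnertonDyer.BirchSwinnertonDyer.Theorems.AdditiveBranchIMCGordTwoRankZeroTransport

/-! ## §1 The parity halves from the Λ-adic children -/

/-- **Item 19244 (even half of crux 19357) BY NAME from item 19497.** `PrintedFacts` (GZK, modularity, a
modular parametrisation), `ReadingFacts` (Delbourgo 1998 Prop. 4 intrinsic), Pal 2012 Thm. 3.2 (the route's
alias leaf `PalQuadraticTwistPeriod` unfolds to it) and the rank-free Λ-adic even-branch containment
`GordTwoLambdaEven` imply `GordTwoRankZeroOffCaseOneEven`: gen 0's transport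
`missingLowerBoundAt_cellGordTwo_rankZero_of_chiBranchLowerDivisibility` pair by pair. Conditional on the
displayed items (19497 is OPEN and not in print); closes nothing by itself.
[cite: Delbourgo1998, Prop. 4 (p. 144)] [cite: Pal2012, Thm. 3.2] [cite: Miller2011LMS, Def. 1.1] -/
theorem gordTwoRankZeroOffCaseOneEven_of_facts_of_gordTwoLambdaEven
    (hP : PrintedFacts) (hR : ReadingFacts)
    (hPal : Pal2012.thm32_sqrt_mul_realPeriodRat_twist_eq_of_prime_one_mod_four)
    (hΛ : GordTwoLambdaEven) : GordTwoRankZeroOffCaseOneEven := by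
  obtain ⟨-, -, -, -, hGZK, hmod, hmodD, -⟩ := hP
  obtain ⟨-, -, -, -, hDelG⟩ := hR
  intro W _ _ p _ hr hc hno hp4
  exact missingLowerBoundAt_cellGordTwo_rankZero_of_chiBranchLowerDivisibility hDelG hPal hGZK hmod hmodD
    hc hp4 hr (hΛ W p hc hno hp4)

/-- **Item 19245 (odd half of crux 19357) BY NAME from item 19498.** `PrintedFacts`, `ReadingFacts` and the
rank-free Λ-adic odd-branch containment `GordTwoLambdaOdd` imply `GordTwoRankZeroOffCaseOneOdd` (no period
item: the odd branch carries minus symbols and the imaginary period): gen 0's transport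
`missingLowerBoundAt_cellGordTwo_rankZero_of_chiBranchLowerDivisibilityOdd` pair by pair, `p = 3` included.
Conditional on the displayed items (19498 is OPEN and not in print); closes nothing by itself.
[cite: Delbourgo1998, Prop. 4 (p. 144)] [cite: MazurTateTeitelbaum1986Invent, §I.14] [cite: Miller2011LMS, Def. 1.1] -/
theorem gordTwoRankZeroOffCaseOneOdd_of_facts_of_gordTwoLambdaOdd
    (hP : PrintedFacts) (hR : ReadingFacts) (hΛ' : GordTwoLambdaOdd) :
    GordTwoRankZeroOffCaseOneOdd := by
  obtain ⟨-, -, -, -, hGZK, hmod, hmodD, -⟩ := hP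
  obtain ⟨-, -, -, -, hDelG⟩ := hR
  intro W _ _ p _ hr hc hno hp4
  exact missingLowerBoundAt_cellGordTwo_rankZero_of_chiBranchLowerDivisibilityOdd hDelG hGZK hmod hmodD
    hc hp4 hr (hΛ' W p hc hno hp4)

/-! ## §2 The parent crux from the Λ-adic children -/

/-- **Crux 19357 BY NAME from items 19497 and 19498** (with `PrintedFacts`, `ReadingFacts`, Pal 2012
Thm. 3.2): the two parity halves of §1 glued by the landed parity glue (`N10.CellGordTwo W p` gives `p ≠ 2`, and
an odd prime is `≡ 1` or `≡ 3 (mod 4)`) — here simply gen 0's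
`gordTwoRankZeroOffCaseOne_of_chiBranchLowerDivisibility` with its two rank-0 binders fed by the rank-free
children. Conditional on the displayed items; closes nothing by itself.
[cite: Delbourgo1998, Prop. 4 (p. 144) and Main Conjecture (p. 151)] [cite: Pal2012, Thm. 3.2]
[cite: Miller2011LMS, Def. 1.1] -/
theorem gordTwoRankZeroOffCaseOne_of_facts_of_gordTwoLambda
    (hP : PrintedFacts) (hR : ReadingFacts)
    (hPal : Pal2012.thm32_sqrt_mul_realPeriodRat_twist_eq_of_prime_one_mod_four)
    (hΛ : GordTwoLambdaEven) (hΛ' : GordTwoLambdaOdd) : GordTwoRankZeroOffCaseOne := by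
  obtain ⟨-, -, -, -, hGZK, hmod, hmodD, -⟩ := hP
  obtain ⟨-, -, -, -, hDelG⟩ := hR
  exact gordTwoRankZeroOffCaseOne_of_chiBranchLowerDivisibility hDelG hPal hGZK hmod hmodD
    (fun W _ _ p _ _ hc hno hp4 => hΛ W p hc hno hp4) (fun W _ _ p _ _ hc hno hp4 => hΛ' W p hc hno hp4)

/-! ## §3 The same with the route's alias items (`PrintedAndReadingFacts` 19478, `PalQuadraticTwistPeriod` 19587) -/

/-- **Item 19244 from the alias pair `PrintedAndReadingFacts`, the alias leaf `PalQuadraticTwistPeriod` and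
item 19497** — §1 with the route's own item names throughout (each alias unfolds definitionally).
[cite: Delbourgo1998, Prop. 4 (p. 144)] [cite: Pal2012, Thm. 3.2] -/
theorem gordTwoRankZeroOffCaseOneEven_of_items
    (hPR : PrintedAndReadingFacts) (hPal : PalQuadraticTwistPeriod) (hΛ : GordTwoLambdaEven) :
    GordTwoRankZeroOffCaseOneEven :=
  gordTwoRankZeroOffCaseOneEven_of_facts_of_gordTwoLambdaEven hPR.1 hPR.2 hPal hΛ

/-- **Item 19245 from the alias pair `PrintedAndReadingFacts` and item 19498** — §1 with the route's own
item names. [cite: Delbourgo1998, Prop. 4 (p. 144)] [cite: MazurTateTeitelbaum1986Invent, §I.14] -/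
theorem gordTwoRankZeroOffCaseOneOdd_of_items
    (hPR : PrintedAndReadingFacts) (hΛ' : GordTwoLambdaOdd) : GordTwoRankZeroOffCaseOneOdd :=
  gordTwoRankZeroOffCaseOneOdd_of_facts_of_gordTwoLambdaOdd hPR.1 hPR.2 hΛ'

/-- **Crux 19357 from the alias pair `PrintedAndReadingFacts`, the alias leaf `PalQuadraticTwistPeriod` and
items 19497, 19498** — §2 with the route's own item names: `PrintedAndReadingFacts → PalQuadraticTwistPeriod
→ GordTwoLambdaEven → GordTwoLambdaOdd → GordTwoRankZeroOffCaseOne`.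
[cite: Delbourgo1998, Prop. 4 (p. 144) and Main Conjecture (p. 151)] [cite: Pal2012, Thm. 3.2] -/
theorem gordTwoRankZeroOffCaseOne_of_items
    (hPR : PrintedAndReadingFacts) (hPal : PalQuadraticTwistPeriod)
    (hΛ : GordTwoLambdaEven) (hΛ' : GordTwoLambdaOdd) : GordTwoRankZeroOffCaseOne :=
  gordTwoRankZeroOffCaseOne_of_facts_of_gordTwoLambda hPR.1 hPR.2 hPal hΛ hΛ'

end Summit.BirchSwinnertonDyer.BirchSwinnertonDyer.Theorems.AdditiveBranchIMCGordTwoRankZeroOfLambda
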